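import Literature.Probability.Percolation.ArcLandedFourArm
import Literature.Probability.Percolation.FourArmPivotalAltLocal
import HarnessLib

/-!
# Pivotal sites of the arc-landed four-arm event: Menger's cut, the local event, the three annuli (proofs only)

Topic `Literature/Probability/Percolation`; family `crit-perc`. PROOFS ONLY (no definition, no
named fact). Serves the named fact `Literature.Probability.Percolation.Werner2009_lemma63`
(Werner 2009, Lecture 6, Lemma 6.3 for the tree's ORDER-FREE `π̂_t`) through P. Nolin,
*Near-critical percolation in two dimensions*, EJP 13 (2008), §6.2, proof of Thm. 27
[arXiv 0711.4948: Thm. 26], **Case 3**, for the host event `arcFourArm a b r₀ N`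
(`ArcLandedFourArm.lean`: two disjoint open arms from the arc `a` of `∂Λ_{r₀}` to the arc `a` of
`∂Λ_N` and two disjoint closed arms between the arcs `b`; Nolin's `Ã = Ã⁺ ∩ Ã⁻` with packs). As
Nolin says, "This new definition allows to use Menger's theorem": if opening `v` creates the
event, Menger's theorem for two paths between the inner arc and the outer arc yields the defect
`P`, and the local analysis of `FourArmPivotalAltLocal.lean` (the cut-point lemma in cluster form,
and the disjoint fifth arm beyond the defect) applies verbatim — its cut hypothesis only concerns
walks between the extremities of the open arm through `v`, which here lie on the two arcs:

* `exists_cut_of_pivotal_plus_arc` — the Menger cut for the host (as `exists_cut_of_pivotal_plus`,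
  with the source and target sets `hexSector r₀ a`, `hexSector N a` in
  `Literature.Combinatorics.SimpleGraph.exists_mem_support_forall`);
* `arcPivotalPlus_subset_localAlt`, `arcPivotalMinus_subset_localAlt`,
  `isPivotal_arcFourArm_subset_localAlt` — **the local event `E(v)` in alternating form**: for
  `l ≥ 1`, `r₀ + 2·2^l ≤ |v|_𝕋 ≤ N - 2·2^l`, a pivotal `v` of `arcFourArm a b r₀ N` has `ω - v` in
  `altFourArm 1 2^{l-1} ∪ (altFourArm 2 2^l □ armEvent ![c] 2 2^l)
   ∪ ⋃_{1 ≤ l' < l} (altFourArm 1 2^{l'-1} ∩ (altFourArm 2^{l'+1} 2^l □ armEvent ![c] 2^{l'+1} 2^l))`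
  for the colour `c` of `v` that creates the event (closing `v` creates `arcFourArm a b` iff
  opening `v` creates `arcFourArm b a` in `ωᶜ`, `compl_preimage_arcFourArm`);
* `isPivotal_arcFourArm_subset_inner`, `isPivotal_arcFourArm_subset_outer` — **the other two
  annuli, TYPED**: a pivotal `v` with `R₁ < |v|_𝕋 < R₂` has `ω ∈ innerArcFourArm a b r₀ R₁`
  (arms truncated at the first visit of `∂Λ_{R₁}` keep their inner landing) and
  `ω ∈ outerArcFourArm a b R₂ N` (final segments keep the outer landing) — inner-, resp.
  outer-landed pieces, hence cyclically adjacent (`innerArcFourArm_subset_adjFourArmCyc`,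
  `outerArcFourArm_subset_adjFourArmCyc`): no cross terms between the two arrangements arise when
  the pieces are glued back by quasi-multiplicativity;
* `measureReal_isPivotal_arcFourArm_le` — the per-site bound
  `P_t(v pivotal for arcFourArm a b r₀ N) ≤ P_t(innerArcFourArm a b r₀ R₁) · P_t(outerArcFourArm a b R₂ N) · (L^alt_T(l) + L^alt_F(l))`
  (`measureReal_le_of_subset_localAlt`).

## References

* P. Nolin, Near-critical percolation in two dimensions, *Electron. J. Probab.* 13 (2008), §6.2,
  proof of Thm. 27, Case 3 [arXiv 0711.4948: Thm. 26] [Nolin2008].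
* W. Werner, *Lectures on two-dimensional critical percolation*, IAS/Park City Math. Ser. 16
  (2009), Lecture 6, §5 (the three annuli) [WernerPCMI2009].
* R. Diestel, *Graph Theory*, 5th ed. (2017), Thm. 3.3.1 (Menger) [Diestel2017].

## Mathlib / tree

Tree: `arcFourArm`, `arcPair`, `innerArcFourArm`, `outerArcFourArm`, `arcFourArm_eq_inter`,
`isLowerSet_arcPair_false`, `mem_arcPair_of_pathIn`, `compl_preimage_arcFourArm`,
`arcFourArm_subset_innerArcFourArm`, `arcFourArm_subset_outerArcFourArm`,
`determinedBy_innerArcFourArm`, `determinedBy_outerArcFourArm`, `hexSector`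
(`ArcLandedFourArm.lean`, `AdjFourArmCyclic.lean`); `relabel_shift_mem_altFourArm_of_cut`,
`relabel_shift_mem_altFourArm_disjointOccurrence_of_cut`, `compl_preimage_disjointOccurrence`,
`measureReal_le_of_subset_localAlt` (`FourArmPivotalAltLocal.lean`); `relabel_compl`
(`FourArmPivotalBound.lean`); `compl_preimage_altFourArm`, `compl_preimage_armEvent`;
`DeterminedBy.insert_mem_iff_of_notMem` (`ArmEventPivotalAnnuli.lean`);
`Literature.Combinatorics.SimpleGraph.exists_mem_support_forall` (`MengerTwo.lean`).
-/

noncomputable section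

open MeasureTheory Set

namespace Literature.Probability.Percolation

open LatticeModels Literature.Combinatorics.SimpleGraph

/-! ### The Menger cut for the host -/

/-- **The defect of a pivotal site of the open pack** (Nolin 2008, §6.2, proof of Thm. 27,
Case 3: "This new definition allows to use Menger's theorem … there exists a path `c_{i'}`
separating `∂S` from `Ĩ_q` … white, except in (at most) `l_q - 1` sites", here `l_q = 2`). If
`r₀ < |v|_𝕋 ≤ N`, opening `v` produces `arcFourArm a b r₀ N` and closing `v` destroys it, then
`ω ∪ {v}` has two vertex-disjoint open self-avoiding arms `o₁ ∋ v`, `o₂` from the arc `a` of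
`∂Λ_{r₀}` to the arc `a` of `∂Λ_N`, and there is a site `P ∈ o₂` lying on EVERY walk from the
inner arc to the outer arc whose sites are open sites of `ω` other than `v` in the annulus. [cite: Nolin2008, §6.2, proof of Thm. 27, Case 3 (arXiv 0711.4948: Thm. 26)] [cite: Diestel2017, Thm. 3.3.1] -/
theorem exists_cut_of_pivotal_plus_arc {a b r₀ N : ℕ} {v : Site 2} {ω : SiteConfig (Site 2)}
    (hr : (r₀ : ℤ) < triNorm v) (hN : triNorm v ≤ N)
    (hplus : insert v ω ∈ arcFourArm a b r₀ N) (hminus : ω \ {v} ∉ arcFourArm a b r₀ N) :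
    ∃ (x₁ y₁ x₂ y₂ P : Site 2) (o₁ : triGraph.Walk x₁ y₁) (o₂ : triGraph.Walk x₂ y₂),
      x₁ ∈ hexSector r₀ a ∧ y₁ ∈ hexSector N a ∧ x₂ ∈ hexSector r₀ a ∧ y₂ ∈ hexSector N a ∧
      o₁.IsPath ∧ o₂.IsPath ∧
      (∀ z ∈ o₁.support, (r₀ : ℤ) ≤ triNorm z ∧ triNorm z ≤ N) ∧
      (∀ z ∈ o₂.support, (r₀ : ℤ) ≤ triNorm z ∧ triNorm z ≤ N) ∧
      v ∈ o₁.support ∧ (∀ z ∈ o₁.support, z ≠ v → z ∈ ω) ∧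
      (∀ z ∈ o₂.support, z ∈ ω ∧ z ≠ v) ∧ (∀ z ∈ o₁.support, z ∉ o₂.support) ∧
      P ∈ o₂.support ∧
      ∀ (s t : Site 2) (q : triGraph.Walk s t), s ∈ hexSector r₀ a → t ∈ hexSector N a →
        (∀ z ∈ q.support, ((r₀ : ℤ) ≤ triNorm z ∧ triNorm z ≤ N) ∧ z ∈ ω ∧ z ≠ v) →
        P ∈ q.support := by
  classical
  have hrN : r₀ ≤ N := by
    have : (r₀ : ℤ) ≤ N := by omega
    exact_mod_cast this
  rw [arcFourArm_eq_inter] at hplus hminus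
  obtain ⟨hO, hC⟩ := hplus
  -- the closed pack survives the closing of `v`
  have hC' : ω \ {v} ∈ arcPair false b r₀ N :=
    isLowerSet_arcPair_false b r₀ N
      (show ω \ {v} ≤ insert v ω from fun z hz => mem_insert_of_mem _ hz.1) hC
  have hO' : ω \ {v} ∉ arcPair true a r₀ N := fun h => hminus ⟨h, hC'⟩
  obtain ⟨x, y, w, hw, hdisj, hl⟩ := hO
  -- the admissible set: open sites of `ω ∖ {v}` in the closed annulus
  obtain ⟨A, hA⟩ : ∃ A : Set (Site 2), ∀ z, z ∈ A ↔
      ((r₀ : ℤ) ≤ triNorm z ∧ triNorm z ≤ N) ∧ z ∈ ω ∧ z ≠ v := ⟨{z | _}, fun _ => Iff.rfl⟩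
  have hann : ∀ j, ∀ z ∈ (w j).support, (r₀ : ℤ) ≤ triNorm z ∧ triNorm z ≤ N := fun j z hz =>
    mem_triAnnulus.1 (mem_triAnnulus_of_arm hrN ((hw j).2.2.2.1 z hz))
  have hcol : ∀ j, ∀ z ∈ (w j).support, z ∈ insert v ω := fun j z hz => by
    simpa using (hw j).2.2.2.2 z hz
  -- `v` lies on one of the two open arms
  have hv : ∃ i, v ∈ (w i).support := by
    by_contra hcon
    push Not at hcon
    refine hO' ⟨x, y, w, fun j => ?_, hdisj, hl⟩
    obtain ⟨hx, hy, hp, hs, -⟩ := hw j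
    refine ⟨hx, hy, hp, hs, fun z hz => ?_⟩
    have hzv : z ≠ v := fun h => hcon j (h ▸ hz)
    have hzω : z ∈ ω := (mem_insert_iff.1 (hcol j z hz)).resolve_left hzv
    simp [hzω, hzv]
  obtain ⟨i, hvi⟩ := hv
  obtain ⟨j, hji⟩ : ∃ j : Fin 2, j ≠ i := by
    fin_cases i
    · exact ⟨1, by decide⟩
    · exact ⟨0, by decide⟩
  have hdisj12 : ∀ z ∈ (w i).support, z ∉ (w j).support := fun z hz hz' =>
    Finset.disjoint_left.1 (hdisj hji.symm) (List.mem_toFinset.2 hz) (List.mem_toFinset.2 hz')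
  have hvj : v ∉ (w j).support := hdisj12 v hvi
  have ho₂A : ∀ z ∈ (w j).support, z ∈ A := fun z hz =>
    (hA z).2 ⟨hann j z hz, (mem_insert_iff.1 (hcol j z hz)).resolve_left (fun h => hvj (h ▸ hz)),
      fun h => hvj (h ▸ hz)⟩
  -- Menger's theorem for two paths between the arcs
  have hone : ∃ (s t : Site 2) (q : triGraph.Walk s t), s ∈ hexSector r₀ a ∧
      t ∈ hexSector N a ∧ ∀ z ∈ q.support, z ∈ A :=
    ⟨x j, y j, w j, (hl j).1, (hl j).2, ho₂A⟩
  have htwo : ¬ ∃ (s₁ t₁ s₂ t₂ : Site 2) (p₁ : triGraph.Walk s₁ t₁) (p₂ : triGraph.Walk s₂ t₂),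
      s₁ ∈ hexSector r₀ a ∧ t₁ ∈ hexSector N a ∧ s₂ ∈ hexSector r₀ a ∧ t₂ ∈ hexSector N a ∧
      p₁.IsPath ∧ p₂.IsPath ∧ (∀ z ∈ p₁.support, z ∈ A) ∧ (∀ z ∈ p₂.support, z ∈ A) ∧
      ∀ z ∈ p₁.support, z ∉ p₂.support := by
    rintro ⟨s₁, t₁, s₂, t₂, p₁, p₂, hs₁, ht₁, hs₂, ht₂, -, -, hp₁A, hp₂A, hdj⟩
    obtain ⟨T, hT⟩ : ∃ T : Fin 2 → Set (Site 2),
        T 0 = {z | z ∈ p₁.support} ∧ T 1 = {z | z ∈ p₂.support} :=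
      ⟨![{z | z ∈ p₁.support}, {z | z ∈ p₂.support}], rfl, rfl⟩
    refine hO' (mem_arcPair_of_pathIn true T ?_ ?_ ?_ ?_)
    · intro c d hcd
      fin_cases c <;> fin_cases d
      · exact absurd rfl hcd
      · change Disjoint (T 0) (T 1)
        rw [hT.1, hT.2]; exact Set.disjoint_left.2 fun z hz hz' => hdj z hz hz'
      · change Disjoint (T 1) (T 0)
        rw [hT.1, hT.2]; exact Set.disjoint_left.2 fun z hz hz' => hdj z hz' hz
      · exact absurd rfl hcd
    · intro c z hz
      fin_cases c
      · change z ∈ T 0 at hz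
        rw [hT.1] at hz
        obtain ⟨-, h2, h3⟩ := (hA z).1 (hp₁A z hz)
        simp [h2, h3]
      · change z ∈ T 1 at hz
        rw [hT.2] at hz
        obtain ⟨-, h2, h3⟩ := (hA z).1 (hp₂A z hz)
        simp [h2, h3]
    · intro c z hz
      fin_cases c
      · change z ∈ T 0 at hz
        rw [hT.1] at hz; exact ((hA z).1 (hp₁A z hz)).1
      · change z ∈ T 1 at hz
        rw [hT.2] at hz; exact ((hA z).1 (hp₂A z hz)).1
    · intro c
      fin_cases c
      · refine ⟨s₁, hs₁, t₁, ht₁, ?_⟩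
        change PathIn triGraph (T 0) s₁ t₁
        rw [hT.1]; exact PathIn.of_walk p₁ fun z hz => hz
      · refine ⟨s₂, hs₂, t₂, ht₂, ?_⟩
        change PathIn triGraph (T 1) s₂ t₂
        rw [hT.2]; exact PathIn.of_walk p₂ fun z hz => hz
  obtain ⟨P, hPA, hPall⟩ := exists_mem_support_forall hone htwo
  have hPo₂ : P ∈ (w j).support := hPall _ _ (w j) (hl j).1 (hl j).2 ho₂A
  exact ⟨x i, y i, x j, y j, P, w i, w j, (hl i).1, (hl i).2, (hl j).1, (hl j).2,
    (hw i).2.2.1, (hw j).2.2.1, hann i, hann j, hvi,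
    fun z hz hzv => (mem_insert_iff.1 (hcol i z hz)).resolve_left hzv,
    fun z hz => ⟨((hA z).1 (ho₂A z hz)).2.1, ((hA z).1 (ho₂A z hz)).2.2⟩, hdisj12, hPo₂,
    fun s t q hs ht hq => hPall s t q hs ht fun z hz => (hA z).2 (hq z hz)⟩

/-! ### The local event at a pivotal site of the host -/

section Local

variable {a b r₀ N l : ℕ} {v : Site 2}

/-- **The local event where OPENING `v` creates the arc-landed four-arm event, alternating form**
(as `pivotalPlus_subset_localAlt`, for the host `arcFourArm a b r₀ N`): with `P` the defect of
`exists_cut_of_pivotal_plus_arc` and `ρ = |P - v|_𝕋 ≥ 1`, if `ρ > 2^{l-1}` then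
`ω - v ∈ altFourArm 1 2^{l-1}`; otherwise `2^{l'} ≤ ρ < 2^{l'+1}` with `l' ≤ l - 1`,
`ω - v ∈ altFourArm 2^{l'+1} 2^l □ armEvent ![T] 2^{l'+1} 2^l` and, if `l' ≥ 1`,
`ω - v ∈ altFourArm 1 2^{l'-1}`. [cite: Nolin2008, §6.2, proof of Thm. 27, Case 3 (arXiv 0711.4948: Thm. 26, event E(v))] [cite: WernerPCMI2009, Lecture 6, §5 ("the three annuli")] -/
theorem arcPivotalPlus_subset_localAlt (hl : 1 ≤ l) (hvr : (r₀ : ℤ) + 2 * 2 ^ l ≤ triNorm v)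
    (hvN : triNorm v + 2 * 2 ^ l ≤ N) {ω : SiteConfig (Site 2)}
    (hplus : insert v ω ∈ arcFourArm a b r₀ N) (hminus : ω \ {v} ∉ arcFourArm a b r₀ N) :
    SiteConfig.relabel (triShiftIso (-v)).toEquiv ω ∈
      (altFourArm 1 (2 ^ (l - 1)) ∪
        (altFourArm 2 (2 ^ l) □ armEvent ![true] 2 (2 ^ l))) ∪
        ⋃ l' ∈ Finset.Ico 1 l, (altFourArm 1 (2 ^ (l' - 1)) ∩
          (altFourArm (2 ^ (l' + 1)) (2 ^ l) □ armEvent ![true] (2 ^ (l' + 1)) (2 ^ l))) := by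
  -- powers of two, as integer atoms
  obtain ⟨M, hM⟩ : ∃ M : ℕ, M = 2 ^ l := ⟨_, rfl⟩
  obtain ⟨M', hM'⟩ : ∃ M' : ℕ, M' = 2 ^ (l - 1) := ⟨_, rfl⟩
  have hMM' : M = 2 * M' := by
    rw [hM, hM']
    obtain ⟨k, rfl⟩ : ∃ k, l = k + 1 := ⟨l - 1, by omega⟩
    rw [Nat.add_sub_cancel, pow_succ]; ring
  have hM'1 : 1 ≤ M' := by rw [hM']; exact Nat.one_le_two_pow
  have hvr' : (r₀ : ℤ) + 2 * M ≤ triNorm v := by rw [hM]; exact_mod_cast hvr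
  have hvN' : triNorm v + 2 * M ≤ N := by rw [hM]; exact_mod_cast hvN
  have hr : (r₀ : ℤ) < triNorm v := by omega
  have hN : triNorm v ≤ N := by omega
  obtain ⟨x₁, y₁, x₂, y₂, P, o₁, o₂, hx₁, hy₁, hx₂, -, -, -, ho₁a, -, -, ho₁ω, ho₂ω,
    hdj, hPo₂, hcut⟩ := exists_cut_of_pivotal_plus_arc hr hN hplus hminus
  have hx₁n : triNorm x₁ = r₀ := triNorm_of_mem_hexSector hx₁
  have hy₁n : triNorm y₁ = N := triNorm_of_mem_hexSector hy₁
  have hx₂n : triNorm x₂ = r₀ := triNorm_of_mem_hexSector hx₂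
  have hPo₁ : P ∉ o₁.support := fun h => hdj P h hPo₂
  have hPv : P ≠ v := (ho₂ω P hPo₂).2
  have hρ1 : 1 ≤ triNorm (P - v) := one_le_triNorm_sub_of_ne hPv
  have hcut' : ∀ q : triGraph.Walk x₁ y₁,
      (∀ z ∈ q.support, ((r₀ : ℤ) ≤ triNorm z ∧ triNorm z ≤ N) ∧ z ∈ ω ∧ z ≠ v) → P ∈ q.support :=
    fun q hq => hcut x₁ y₁ q hx₁ hy₁ hq
  by_cases hfar : (M' : ℤ) < triNorm (P - v)
  · -- four alternating arms up to `2^(l-1)`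
    refine mem_union_left _ (mem_union_left _ ?_)
    rw [← hM']
    exact relabel_shift_mem_altFourArm_of_cut o₁ hM'1 (by omega) (by omega) hx₁n hy₁n ho₁a ho₁ω
      hPo₁ hcut' hfar
  · -- the dyadic scale `l'` of the defect
    push Not at hfar
    set n : ℕ := (triNorm (P - v)).toNat with hn
    have hnρ : (n : ℤ) = triNorm (P - v) := Int.toNat_of_nonneg (by omega)
    have hn0 : n ≠ 0 := by intro h; rw [h] at hnρ; omega
    set l' : ℕ := Nat.log 2 n with hl'
    have h1 : 2 ^ l' ≤ n := Nat.pow_log_le_self 2 hn0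
    have h2 : n < 2 ^ (l' + 1) := Nat.lt_pow_succ_log_self (by norm_num) n
    have hnM' : n ≤ M' := by
      have : (n : ℤ) ≤ M' := by omega
      exact_mod_cast this
    have hl'l : l' + 1 ≤ l := by
      have h3 : 2 ^ l' ≤ 2 ^ (l - 1) := by rw [← hM']; exact h1.trans hnM'
      have h4 : l' ≤ l - 1 := (Nat.pow_le_pow_iff_right (by norm_num)).1 h3
      omega
    -- four alternating arms and a disjoint open arm from `2^(l'+1)` to `2^l`
    have hfive : SiteConfig.relabel (triShiftIso (-v)).toEquiv ω ∈
        altFourArm (2 ^ (l' + 1)) (2 ^ l) □ armEvent ![true] (2 ^ (l' + 1)) (2 ^ l) := by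
      have hM1 : 1 ≤ M := by omega
      have h := relabel_shift_mem_altFourArm_disjointOccurrence_of_cut (R := M) (r' := 2 ^ (l' + 1))
        o₁ o₂ hM1 hvr' hvN' Nat.one_le_two_pow
        (by rw [hM]; exact Nat.pow_le_pow_right (by norm_num) hl'l)
        (by rw [← hnρ]; exact_mod_cast h2) hx₁n hy₁n hx₂n ho₁a ho₁ω ho₂ω hdj hPo₂ hcut'
      rwa [hM] at h
    by_cases hl'0 : l' = 0
    · refine mem_union_left _ (mem_union_right _ ?_)
      rw [hl'0, zero_add, pow_one] at hfive
      exact hfive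
    · -- four alternating arms up to `2^(l'-1)`
      refine mem_union_right _ (mem_iUnion₂.2 ⟨l', Finset.mem_Ico.2 ⟨by omega, by omega⟩, ?_,
        hfive⟩)
      have hd1 : 1 ≤ 2 ^ (l' - 1) := Nat.one_le_two_pow
      have hdlt : 2 ^ (l' - 1) < n := by
        have : 2 ^ (l' - 1) < 2 ^ l' := Nat.pow_lt_pow_right (by norm_num) (by omega)
        omega
      have hdM : 2 * 2 ^ (l' - 1) ≤ M := by
        have : 2 ^ (l' - 1) ≤ M' := by omega
        omega
      refine relabel_shift_mem_altFourArm_of_cut o₁ hd1 ?_ ?_ hx₁n hy₁n ho₁a ho₁ω hPo₁ hcut' ?_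
      · have : (2 : ℤ) * ((2 ^ (l' - 1) : ℕ) : ℤ) ≤ M := by exact_mod_cast hdM
        omega
      · have : (2 : ℤ) * ((2 ^ (l' - 1) : ℕ) : ℤ) ≤ M := by exact_mod_cast hdM
        omega
      · rw [← hnρ]; exact_mod_cast hdlt

/-- **The local event where CLOSING `v` creates the arc-landed four-arm event**: closing `v`
creates `arcFourArm a b r₀ N` in `ω` iff opening `v` creates `arcFourArm b a r₀ N` in `ωᶜ`
(`compl_preimage_arcFourArm`), whence the same local event with the fifth arm closed. [cite: Nolin2008, §6.2, proof of Thm. 27, Case 3 ("If we then do the same manipulation on the second term")] -/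
theorem arcPivotalMinus_subset_localAlt (hl : 1 ≤ l) (hvr : (r₀ : ℤ) + 2 * 2 ^ l ≤ triNorm v)
    (hvN : triNorm v + 2 * 2 ^ l ≤ N) {ω : SiteConfig (Site 2)}
    (hminus : ω \ {v} ∈ arcFourArm a b r₀ N) (hplus : insert v ω ∉ arcFourArm a b r₀ N) :
    SiteConfig.relabel (triShiftIso (-v)).toEquiv ω ∈
      (altFourArm 1 (2 ^ (l - 1)) ∪
        (altFourArm 2 (2 ^ l) □ armEvent ![false] 2 (2 ^ l))) ∪
        ⋃ l' ∈ Finset.Ico 1 l, (altFourArm 1 (2 ^ (l' - 1)) ∩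
          (altFourArm (2 ^ (l' + 1)) (2 ^ l) □ armEvent ![false] (2 ^ (l' + 1)) (2 ^ l))) := by
  have hc1 : insert v ωᶜ = (ω \ {v})ᶜ := by
    ext z; simp only [mem_insert_iff, mem_compl_iff, mem_sdiff, mem_singleton_iff]; tauto
  have hc2 : ωᶜ \ {v} = (insert v ω)ᶜ := by
    ext z; simp only [mem_insert_iff, mem_compl_iff, mem_sdiff, mem_singleton_iff]; tauto
  have hplus' : insert v ωᶜ ∈ arcFourArm b a r₀ N := by
    rw [hc1, ← Set.mem_preimage, compl_preimage_arcFourArm]; exact hminus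
  have hminus' : ωᶜ \ {v} ∉ arcFourArm b a r₀ N := by
    rw [hc2, ← Set.mem_preimage, compl_preimage_arcFourArm]; exact hplus
  have h := arcPivotalPlus_subset_localAlt hl hvr hvN hplus' hminus'
  rw [relabel_compl] at h
  have hvec : (fun j => !(![true] : Fin 1 → Bool) j) = ![false] := by
    funext j; fin_cases j; rfl
  have hA : ∀ r R : ℕ, (SiteConfig.relabel (triShiftIso (-v)).toEquiv ω)ᶜ ∈ altFourArm r R ↔
      SiteConfig.relabel (triShiftIso (-v)).toEquiv ω ∈ altFourArm r R := by
    intro r R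
    rw [← Set.mem_preimage, compl_preimage_altFourArm]
  have hD : ∀ r R : ℕ, (SiteConfig.relabel (triShiftIso (-v)).toEquiv ω)ᶜ ∈
      altFourArm r R □ armEvent ![true] r R ↔
      SiteConfig.relabel (triShiftIso (-v)).toEquiv ω ∈ altFourArm r R □ armEvent ![false] r R := by
    intro r R
    rw [← Set.mem_preimage, compl_preimage_disjointOccurrence, compl_preimage_altFourArm,
      compl_preimage_armEvent, hvec]
  simp only [mem_union, mem_iUnion, mem_inter_iff, exists_prop] at h ⊢
  rcases h with (h | h) | ⟨l', hl', h⟩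
  · exact Or.inl (Or.inl ((hA _ _).1 h))
  · exact Or.inl (Or.inr ((hD _ _).1 h))
  · exact Or.inr ⟨l', hl', (hA _ _).1 h.1, (hD _ _).1 h.2⟩

/-- **The local event at a pivotal site of the arc-landed four-arm event, both cases.** [cite: Nolin2008, §6.2, proof of Thm. 27, Case 3 (arXiv 0711.4948: Thm. 26, event E(v))] [cite: WernerPCMI2009, Lecture 6, §5] -/
theorem isPivotal_arcFourArm_subset_localAlt (hl : 1 ≤ l) (hvr : (r₀ : ℤ) + 2 * 2 ^ l ≤ triNorm v)
    (hvN : triNorm v + 2 * 2 ^ l ≤ N) {ω : SiteConfig (Site 2)}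
    (hpiv : IsPivotal (arcFourArm a b r₀ N) v ω) :
    ∃ c : Bool, SiteConfig.relabel (triShiftIso (-v)).toEquiv ω ∈
      (altFourArm 1 (2 ^ (l - 1)) ∪
        (altFourArm 2 (2 ^ l) □ armEvent ![c] 2 (2 ^ l))) ∪
        ⋃ l' ∈ Finset.Ico 1 l, (altFourArm 1 (2 ^ (l' - 1)) ∩
          (altFourArm (2 ^ (l' + 1)) (2 ^ l) □ armEvent ![c] (2 ^ (l' + 1)) (2 ^ l))) := by
  rcases hpiv with ⟨hplus, hminus⟩ | ⟨hminus, hplus⟩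
  · exact ⟨true, arcPivotalPlus_subset_localAlt hl hvr hvN hplus hminus⟩
  · exact ⟨false, arcPivotalMinus_subset_localAlt hl hvr hvN hminus hplus⟩

end Local

/-! ### The inner and the outer annulus, typed -/

section Annuli

variable {a b r₀ N R₁ R₂ : ℕ} {v : Site 2}

/-- **Pivotal for the host ⇒ inner-landed arms in the inner annulus** (Werner's first annulus;
Nolin's `A_{j,σ}(2^{k₀}, 2^l)`, here TYPED by the inner landing): if `v` is pivotal for
`arcFourArm a b r₀ N` and `r₀ ≤ R₁ ≤ N`, `R₁ < |v|_𝕋`, then `ω ∈ innerArcFourArm a b r₀ R₁`. [cite: WernerPCMI2009, Lecture 6, §5 (the three annuli)] [cite: Nolin2008, §6.2, proof of Thm. 27 ("by quasi-multiplicativity", the inner annulus)] -/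
theorem isPivotal_arcFourArm_subset_inner (hr : r₀ ≤ R₁) (hN : R₁ ≤ N) (hv : (R₁ : ℤ) < triNorm v) :
    {ω : SiteConfig (Site 2) | IsPivotal (arcFourArm a b r₀ N) v ω} ⊆ innerArcFourArm a b r₀ R₁ := by
  intro ω hω
  have hω' : (insert v ω ∈ arcFourArm a b r₀ N ∧ ¬ ω \ {v} ∈ arcFourArm a b r₀ N) ∨
      (ω \ {v} ∈ arcFourArm a b r₀ N ∧ ¬ insert v ω ∈ arcFourArm a b r₀ N) := hω
  have hvF : v ∉ (↑(triAnnulus r₀ R₁) : Set (Site 2)) := by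
    rw [Finset.mem_coe, mem_triAnnulus]; omega
  have hdet := (determinedBy_innerArcFourArm (a := a) (b := b) hr).insert_mem_iff_of_notMem hvF ω
  rcases hω' with ⟨h, -⟩ | ⟨h, -⟩
  · exact hdet.1.1 (arcFourArm_subset_innerArcFourArm hr hN h)
  · exact hdet.2.1 (arcFourArm_subset_innerArcFourArm hr hN h)

/-- **Pivotal for the host ⇒ outer-landed arms in the outer annulus** (Werner's third annulus;
Nolin's `Ā^{./I'}(2^{l+3}, 2^K)`): if `v` is pivotal for `arcFourArm a b r₀ N` and
`r₀ ≤ R₂ ≤ N`, `|v|_𝕋 < R₂`, then `ω ∈ outerArcFourArm a b R₂ N`. [cite: WernerPCMI2009, Lecture 6, §5 (the three annuli)] [cite: Nolin2008, §6.2, proof of Thm. 27 (the outer annulus)] -/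
theorem isPivotal_arcFourArm_subset_outer (hr : r₀ ≤ R₂) (hN : R₂ ≤ N) (hv : triNorm v < R₂) :
    {ω : SiteConfig (Site 2) | IsPivotal (arcFourArm a b r₀ N) v ω} ⊆ outerArcFourArm a b R₂ N := by
  intro ω hω
  have hω' : (insert v ω ∈ arcFourArm a b r₀ N ∧ ¬ ω \ {v} ∈ arcFourArm a b r₀ N) ∨
      (ω \ {v} ∈ arcFourArm a b r₀ N ∧ ¬ insert v ω ∈ arcFourArm a b r₀ N) := hω
  have hvF : v ∉ (↑(triAnnulus R₂ N) : Set (Site 2)) := by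
    rw [Finset.mem_coe, mem_triAnnulus]; omega
  have hdet := (determinedBy_outerArcFourArm (a := a) (b := b) hN).insert_mem_iff_of_notMem hvF ω
  rcases hω' with ⟨h, -⟩ | ⟨h, -⟩
  · exact hdet.1.1 (arcFourArm_subset_outerArcFourArm hr hN h)
  · exact hdet.2.1 (arcFourArm_subset_outerArcFourArm hr hN h)

/-- **The per-site pivotal bound for the arc-landed host with alternating local factors**
(Werner 2009, Lecture 6, §5, the three annuli; Nolin 2008, §6.2, proof of Thm. 27, Case 3): for
`l ≥ 1`, `r₀ + 2·2^l ≤ |v|_𝕋 ≤ N - 2·2^l`, `r₀ ≤ R₁`, `R₁ + 2^l < |v|_𝕋 < R₂ - 2^l`, `R₂ ≤ N`,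
`P_t(v pivotal for arcFourArm a b r₀ N)
  ≤ P_t(innerArcFourArm a b r₀ R₁) · P_t(outerArcFourArm a b R₂ N) · (L^alt_T(l) + L^alt_F(l))`.
[cite: WernerPCMI2009, Lecture 6, §5 ("Using differential inequalities for the four arm event")] [cite: Nolin2008, §6.2, proof of Thm. 27, Case 3 (arXiv 0711.4948: Thm. 26)] -/
theorem measureReal_isPivotal_arcFourArm_le {l : ℕ} (t : unitInterval) (hl : 1 ≤ l)
    (hvr : (r₀ : ℤ) + 2 * 2 ^ l ≤ triNorm v) (hvN : triNorm v + 2 * 2 ^ l ≤ N) (hR₀ : r₀ ≤ R₁)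
    (hR₁v : (R₁ : ℤ) + 2 ^ l < triNorm v) (hR₂v : triNorm v + 2 ^ l < R₂) (hR₂N : R₂ ≤ N) :
    (triSitePercolation t).real {ω | IsPivotal (arcFourArm a b r₀ N) v ω} ≤
      (triSitePercolation t).real (innerArcFourArm a b r₀ R₁) *
        (triSitePercolation t).real (outerArcFourArm a b R₂ N) *
        ∑ c : Bool, (altFourArmProbAt t 1 (2 ^ (l - 1)) +
          altFourArmProbAt t 2 (2 ^ l) * (triSitePercolation t).real (armEvent ![c] 2 (2 ^ l)) +
          ∑ l' ∈ Finset.Ico 1 l, altFourArmProbAt t 1 (2 ^ (l' - 1)) *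
            (altFourArmProbAt t (2 ^ (l' + 1)) (2 ^ l) *
              (triSitePercolation t).real (armEvent ![c] (2 ^ (l' + 1)) (2 ^ l)))) := by
  classical
  set μ := triSitePercolation t with hμ
  set E := arcFourArm a b r₀ N with hE
  set In := innerArcFourArm a b r₀ R₁ with hIn
  set Out := outerArcFourArm a b R₂ N with hOut
  have h2pos : (0 : ℤ) < 2 ^ l := by positivity
  have hInF : DeterminedBy In ↑(triAnnulus r₀ R₁) := determinedBy_innerArcFourArm hR₀
  have hOutF : DeterminedBy Out ↑(triAnnulus R₂ N) := determinedBy_outerArcFourArm hR₂N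
  have hFIn : ∀ z ∈ triAnnulus r₀ R₁, triNorm z + 2 ^ l < triNorm v := fun z hz => by
    rw [mem_triAnnulus] at hz; omega
  have hFOut : ∀ z ∈ triAnnulus R₂ N, triNorm v + 2 ^ l < triNorm z := fun z hz => by
    rw [mem_triAnnulus] at hz; omega
  -- split by the colour that creates the event
  set S : Bool → Set (SiteConfig (Site 2)) := fun c => {ω | IsPivotal E v ω ∧
    SiteConfig.relabel (triShiftIso (-v)).toEquiv ω ∈
      (altFourArm 1 (2 ^ (l - 1)) ∪
        (altFourArm 2 (2 ^ l) □ armEvent ![c] 2 (2 ^ l))) ∪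
        ⋃ l' ∈ Finset.Ico 1 l, (altFourArm 1 (2 ^ (l' - 1)) ∩
          (altFourArm (2 ^ (l' + 1)) (2 ^ l) □ armEvent ![c] (2 ^ (l' + 1)) (2 ^ l)))} with hS
  have hsub : {ω | IsPivotal E v ω} ⊆ S true ∪ S false := by
    intro ω hω
    obtain ⟨c, hc⟩ := isPivotal_arcFourArm_subset_localAlt hl hvr hvN hω
    cases c
    · exact Or.inr ⟨hω, hc⟩
    · exact Or.inl ⟨hω, hc⟩
  have hSle : ∀ c : Bool, μ.real (S c) ≤ μ.real In * μ.real Out *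
      (altFourArmProbAt t 1 (2 ^ (l - 1)) +
        altFourArmProbAt t 2 (2 ^ l) * μ.real (armEvent ![c] 2 (2 ^ l)) +
        ∑ l' ∈ Finset.Ico 1 l, altFourArmProbAt t 1 (2 ^ (l' - 1)) *
          (altFourArmProbAt t (2 ^ (l' + 1)) (2 ^ l) *
            μ.real (armEvent ![c] (2 ^ (l' + 1)) (2 ^ l)))) := fun c =>
    measureReal_le_of_subset_localAlt t c hl (S := S c) hInF hOutF hFIn hFOut
      (fun ω hω => isPivotal_arcFourArm_subset_inner hR₀ (by omega) (by omega) hω.1)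
      (fun ω hω => isPivotal_arcFourArm_subset_outer (by omega) hR₂N (by omega) hω.1)
      (fun ω hω => hω.2)
  calc μ.real {ω | IsPivotal E v ω} ≤ μ.real (S true ∪ S false) :=
        measureReal_mono hsub (measure_ne_top _ _)
    _ ≤ μ.real (S true) + μ.real (S false) := measureReal_union_le _ _
    _ ≤ _ := by
        rw [Fintype.sum_bool, mul_add]
        exact add_le_add (hSle true) (hSle false)

end Annuli

end Literature.Probability.Percolation
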